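import Literature.Probability.LatticeModels.MedialCycleSeparation
import Literature.Probability.LatticeModels.MedialCycleHopf
import HarnessLib

/-!
# Node 1 of crit-ising.S18, corrected form: the discharge

Topic `Literature/Probability/LatticeModels`; sibling `…Proofs` file of `FKInterfacePairing.lean`
(where the named fact `isSHolomorphic_fkIsingObservable_of_zdArcA_connected` — Smirnov's
s-holomorphicity of the critical FK-Ising observable for admissible Dobrushin data with a
connected wired arc, Ann. Math. 172 (2010), Lemma 4.5 with Remark 4.6 — is vendored). The ten
instalments of the discharge programme reduced it to the planar fact T2 `medialCycle_turning`
(`isSHolomorphic_fkIsingObservable_of_zdArcA_connected_of_turning`, `MedialCycleSeparation.lean`);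
T2 is now a theorem (`medialCycle_turning_holds`, `MedialCycleHopf.lean`; a second proof via
Hopf's Umlaufsatz for simple closed polygons, `Topology/PlaneTopology/PolygonUmlaufsatz.lean`, is
in `MedialCycleTurning.lean`), so the corrected node-1 fact is unconditional:
`isSHolomorphic_fkIsingObservable_of_zdArcA_connected_holds`. Nothing else is in this file.

The tree's original, unconditional `isSHolomorphic_fkIsingObservable` (`FermionicObservable.lean`)
is NOT discharged and is very probably false as stated (wired islands: `IsZdAdmissible` does not
make the discrete wired arc connected through `Ω_δ`; see the module docstring of
`FKInterfacePairing.lean`); the statement the printed proof supports is the `_of_zdArcA_connected`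
form proved here.
-/

namespace Literature.Probability.LatticeModels

/-- **Smirnov's s-holomorphicity of the critical FK-Ising observable, connected wired arc —
proved** (the named fact `isSHolomorphic_fkIsingObservable_of_zdArcA_connected` of
`FKInterfacePairing.lean` discharged): for admissible Dobrushin data on `δℤ²` whose discrete arc `A`
is connected through the edges of `Ω_δ`, some nonzero constant multiple of the FK-Ising fermionic
observable at `p_c = √2/(1+√2)` is s-holomorphic on the interior medial vertices. Assembled from
`isSHolomorphic_fkIsingObservable_of_zdArcA_connected_of_turning` (the pairing/weight-table/
projection instalments, `MedialCycleSeparation.lean`) and the Umlaufsatz for cycles of the turning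
rule `medialCycle_turning_holds` (`MedialCycleHopf.lean`). [cite: Smirnov2010, Lemma 4.5 and Remark 4.6] -/
theorem isSHolomorphic_fkIsingObservable_of_zdArcA_connected_holds :
    isSHolomorphic_fkIsingObservable_of_zdArcA_connected :=
  isSHolomorphic_fkIsingObservable_of_zdArcA_connected_of_turning medialCycle_turning_holds

end Literature.Probability.LatticeModels
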